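import Summits.QuantumFields.BalabanUV.Beta.EriceRemainderEnclosureHistoryAutonomyComparisonAgeCompositionTwoAgesOldRead
import Summits.QuantumFields.BalabanUV.Beta.EriceRemainderEnclosureHistoryAutonomyComparisonAgeCompositionIdentificationEnd

/-!
# EriceRemainderEnclosureHistoryAutonomyComparisonAgeCompositionOldReadVariationThree — (E108a) route (N), first order: THE RATE CONSTANT IS THREE, NOT FOUR.
# Every cascade of route (N) since (E95) prices the slow variation of an old read by (E95b) `old_read_variation_of_bound`: over `d` steps the read of
# age `k` drops by at most `4d·c_k(m)·T` = `d` entering targets (`1`) + the coefficient drop on the common targets (`3`, from the CUBIC persistence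
# (E91a) `old_coeff_persist`: `(k+d)³c_k(m+d)Πg ≥ k³c_k(m)`, i.e. level persistence `(h′∕h)² ≥ k∕(k+d)` to the power `3∕2` and the damping product
# `Πg ≥ (m+k+2)∕(m+k+d+2) ≥ k∕(k+d)` from `g_t ≥ (t+1)∕(t+2)`).  The damping letter is wasteful: the row mass below the pin is `F_t ≤ 1∕(2t)` ((E75b)
# `rowMass_le`), so `g_t ≥ 2t∕(2t+1)` and, by `(2t∕(2t+1))² ≥ (2t−1)∕(2t+1)` and telescoping, `(Π_{t∈[s,s+d)} g_t)² ≥ (2s−1)∕(2s+2d−1) ≥ k∕(k+d)`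
# for `s = m+k+1`.  Hence the SQUARE persistence **`old_coeff_persist_sq`**: `(k+d)²·c_k(m+d)·Πg ≥ k²·c_k(m)` (exponent `3∕2 + 1∕2 = 2`), the drop
# `≤ 2d·c_k(m)∕(k+d)`, and **`old_read_variation_of_bound_three`**: the variation is `≤ 3d·c_k(m)·T`.  Consequence (sequels (E108b∕c)): the adaptive
# engine's closure reads `hi_{j−1}·(3X_j(1+κ_j) + κ_j) ≤ κ_{j−1}·(1 − X_j(1+κ_j))·lo_j` — every separation threshold of the census that came from the
# `4` rescales by `3∕4` (singleton chains `×58 → ×44`, towers `16 → 12`, `12 → 9` with the same tables' shapes).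

Cell `pub-balaban`, β-function sub-cell, BINDER row D4 «RemainderConst leaves for Bałaban's split» (`HOME/BINDER-OWNERS.md`; owner lineage `b2b-balaban-beta-an4`;
this file by co-owner #2 lineage `b2b-balaban-beta-d4-p2`, generation 90), β-FLOW TEAM duty (1), FREEZE (0) honoured (def-free; nothing restated; uses (E91a)
`old_read_eq`, (E80a) `mul_sq_le_from_pin`, (E75b) `rowMass_le`, (E48a) `strictAnti_of_memFlow` BY NAME).

HONEST FRAMING (page 1, verbatim and binding).  *"Discharging BetaPertH makes Bałaban's UV stability UNCONDITIONAL — a real constructive-QFT result; it is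
NOT the continuum limit and NOT the Clay problem."*  THIS FILE DISCHARGES NOTHING OF THE KIND.  Elementary real algebra ∕ real analysis about ABSTRACT
functionals on a box ]0,γ]^ℕ with displayed floors, profiles and signs, and the FIRST-ORDER renewal objects of route (N) built from them — hypotheses of a
census, not facts; the form, signs, ages and moments of Bałaban's (1.22) limit functional are NOT PRINTED ([I] p. 298; GAPS G-t4-U2-1∕-2) and NOT asserted.
Row D4 class UNCHANGED (critical-path width 0; instance 0∕1; D4 DISCHARGE NO DATE).  HONEST DEPENDENCY: continuum YM on T⁴ ⇐ BetaPertH ∧ nine spine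
estimates (0/9 proved); BetaPertH ⇐ (D1) ∧ (D4) ∧ CAP+tail; G-an2-4 gates asym, D1 and NE2/3/4.

THE POINT (README `HOME/b2b-balaban-beta-d4-p2/g90/README.md` §6).  NOT CLAIMED: a constant below 3 (the entering targets' `1` and the level persistence's
`3∕2` are sharp letter by letter; the damping's `1∕2` is sharp for the class `g_t(1+F_t) ≥ 1`); anything printed — NOT B12 Thm 2, NOT BetaPertH, NOT
continuum, NOT Clay.

WHAT IS PROVED ([folklore]; 0 `def`, 0 sorry).  §1 `damping_ge_sharp` (`g_t ≥ 2t∕(2t+1)`, `t ≥ 1`), **`damping_prod_sq_ge`**, **`old_coeff_persist_sq`**.  §2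
**`old_read_variation_of_bound_three`**.
-/
noncomputable section
open Finset

namespace Summit.QuantumFields.BalabanUV.Beta.EriceRemainderEnclosureHistoryAutonomyComparisonAgeCompositionOldReadVariationThree

open Literature.MathematicalPhysics.QuantumFieldTheory.Balaban1983to89
open Literature.MathematicalPhysics.QuantumFieldTheory.Balaban1983to89.T4BetaStationary
open Literature.MathematicalPhysics.QuantumFieldTheory.Balaban1983to89.T4BetaFlowWellPosed
open Summit.QuantumFields.BalabanUV.Beta.EriceRemainderEnclosureHistoryAutonomyOrder (strictAnti_of_memFlow)
open Summit.QuantumFields.BalabanUV.Beta.EriceRemainderEnclosureHistoryAutonomyComparisonAgeCompositionWindowShares (mul_sq_le_from_pin)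
open Summit.QuantumFields.BalabanUV.Beta.EriceRemainderEnclosureHistoryAutonomyComparisonAgeCompositionTwoAgesOldRead (old_read_eq)
open Summit.QuantumFields.BalabanUV.Beta.EriceRemainderEnclosureHistoryAutonomyComparisonAgeCompositionIdentificationEnd (rowMass_le)

variable {B : (ℕ → ℝ) → ℝ} {γ b gIR : ℝ} {L : ℕ → ℝ} {K : ℕ} {h g : ℕ → ℝ}

/-! ## §1 Sharp damping persistence and the square persistence of the old coefficient -/

/-- **DAMPINGS OF THE SELF-CONSISTENT CLASS, SHARP FORM**: `g_t(1+F_t) ≥ 1` and `F_t ≤ 1∕(2t)` (`t ≥ 1`, (E75b) `rowMass_le` below the pin `0`) give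
`g_t ≥ 2t∕(2t+1)`. [folklore] -/
theorem damping_ge_sharp (hmono : ∀ u v : ℕ → ℝ, SeqBox γ u → SeqBox γ v → (∀ j, u j ≤ v j) → B u ≤ B v) (hL : ∀ k, 0 ≤ L k) (hb : 0 < b)
    (hlo : ∀ u, SeqBox γ u → b ≤ B u) (hdom : ∀ u, SeqBox γ u → ∑ k ∈ range K, L k * u k ≤ B u) (hh : SeqBox γ h) (hf : MemFlow B gIR h)
    (hg : ∀ t, 0 < g t ∧ g t ≤ 1) (hgF : ∀ t, 1 ≤ g t * (1 + ∑ k ∈ range K, L k * h (t + k) ^ 3 / 2)) {t : ℕ} (ht : 1 ≤ t) :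
    2 * (t : ℝ) / (2 * (t : ℝ) + 1) ≤ g t := by
  have hF := rowMass_le hmono hL hb hlo hdom hh hf 0 ht
  simp only [Nat.zero_add] at hF
  have htr : (1 : ℝ) ≤ t := by exact_mod_cast ht
  have hg0 := (hg t).1
  have h1 := hgF t
  have h2 : 1 ≤ g t * (1 + 1 / (2 * (t : ℝ))) := h1.trans (mul_le_mul_of_nonneg_left (by linarith) hg0.le)
  rw [div_le_iff₀ (by linarith)]
  have e : g t * (1 + 1 / (2 * (t : ℝ))) * (2 * (t : ℝ)) = g t * (2 * (t : ℝ) + 1) := by field_simp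
  nlinarith [mul_le_mul_of_nonneg_right h2 (show (0 : ℝ) ≤ 2 * (t : ℝ) by linarith)]

/-- **SHARP DAMPING PRODUCTS**: `(Π_{t∈[s,s+d)} g_t)² ≥ (2s−1)∕(2s+2d−1)` for `s ≥ 1` — from `g_t ≥ 2t∕(2t+1)`, `(2t∕(2t+1))² ≥ (2t−1)∕(2t+1)` and
telescoping. [folklore] -/
theorem damping_prod_sq_ge (hmono : ∀ u v : ℕ → ℝ, SeqBox γ u → SeqBox γ v → (∀ j, u j ≤ v j) → B u ≤ B v) (hL : ∀ k, 0 ≤ L k) (hb : 0 < b)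
    (hlo : ∀ u, SeqBox γ u → b ≤ B u) (hdom : ∀ u, SeqBox γ u → ∑ k ∈ range K, L k * u k ≤ B u) (hh : SeqBox γ h) (hf : MemFlow B gIR h)
    (hg : ∀ t, 0 < g t ∧ g t ≤ 1) (hgF : ∀ t, 1 ≤ g t * (1 + ∑ k ∈ range K, L k * h (t + k) ^ 3 / 2)) {s : ℕ} (hs : 1 ≤ s) (d : ℕ) :
    (2 * (s : ℝ) - 1) / (2 * (s : ℝ) + 2 * d - 1) ≤ (∏ t ∈ Ico s (s + d), g t) ^ 2 := by
  have hsr : (1 : ℝ) ≤ s := by exact_mod_cast hs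
  induction d with
  | zero =>
    simp only [Nat.cast_zero, mul_zero, add_zero, Ico_self, prod_empty, one_pow]
    exact div_self_le_one _
  | succ d ih =>
    rw [show s + (d + 1) = s + d + 1 by ring, prod_Ico_succ_top (by omega), mul_pow]
    have hgt := damping_ge_sharp hmono hL hb hlo hdom hh hf hg hgF (t := s + d) (by omega)
    have hd : (0 : ℝ) ≤ d := Nat.cast_nonneg d
    have hP0 : 0 ≤ (∏ t ∈ Ico s (s + d), g t) ^ 2 := sq_nonneg _
    have hg0 := (hg (s + d)).1
    push_cast at hgt ⊢
    -- (2(s+d)∕(2(s+d)+1))² ≥ (2(s+d)−1)∕(2(s+d)+1)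
    have hsq : (2 * ((s : ℝ) + d) - 1) / (2 * ((s : ℝ) + d) + 1) ≤ g (s + d) ^ 2 := by
      have hq : (2 * ((s : ℝ) + d) - 1) / (2 * ((s : ℝ) + d) + 1) ≤ (2 * ((s : ℝ) + d) / (2 * ((s : ℝ) + d) + 1)) ^ 2 := by
        rw [div_pow, div_le_div_iff₀ (by positivity) (by positivity)]; nlinarith
      have hq2 : (2 * ((s : ℝ) + d) / (2 * ((s : ℝ) + d) + 1)) ^ 2 ≤ g (s + d) ^ 2 := pow_le_pow_left₀ (by positivity) hgt 2
      exact hq.trans hq2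
    have hA : 2 * (s : ℝ) + 2 * d - 1 ≠ 0 := ne_of_gt (by linarith)
    have hB : 2 * ((s : ℝ) + d) + 1 ≠ 0 := ne_of_gt (by linarith)
    have hC : 2 * (s : ℝ) + 2 * ((d : ℝ) + 1) - 1 ≠ 0 := ne_of_gt (by linarith)
    have hfrac : (2 * (s : ℝ) - 1) / (2 * (s : ℝ) + 2 * ((d : ℝ) + 1) - 1)
        = (2 * (s : ℝ) - 1) / (2 * (s : ℝ) + 2 * d - 1) * ((2 * ((s : ℝ) + d) - 1) / (2 * ((s : ℝ) + d) + 1)) := by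
      rw [div_mul_div_comm, div_eq_div_iff hC (mul_ne_zero hA hB)]
      ring
    rw [hfrac]
    have hq0 : 0 ≤ (2 * (s : ℝ) - 1) / (2 * (s : ℝ) + 2 * d - 1) := by apply div_nonneg <;> linarith
    calc (2 * (s : ℝ) - 1) / (2 * (s : ℝ) + 2 * d - 1) * ((2 * ((s : ℝ) + d) - 1) / (2 * ((s : ℝ) + d) + 1))
        ≤ (∏ t ∈ Ico s (s + d), g t) ^ 2 * ((2 * ((s : ℝ) + d) - 1) / (2 * ((s : ℝ) + d) + 1)) :=
          mul_le_mul_of_nonneg_right ih (by apply div_nonneg <;> linarith)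
      _ ≤ (∏ t ∈ Ico s (s + d), g t) ^ 2 * g (s + d) ^ 2 := mul_le_mul_of_nonneg_left hsq hP0

/-- **SQUARE PERSISTENCE OF THE OLD COEFFICIENT ACROSS THE YOUNG WINDOW**: `(k+d)²·c_k(m+d)·Π_{t∈[m+k+1, m+k+d+1)} g_t ≥ k²·c_k(m)` — level persistence
`(k+d)·h_{m+k+d}² ≥ k·h_{m+k}²` from the pin and `(Πg)² ≥ (2(m+k)+1)∕(2(m+k)+2d+1) ≥ k∕(k+d)`: `(h′∕h)³·Πg ≥ (k∕(k+d))^{3∕2+1∕2}`. [folklore] -/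
theorem old_coeff_persist_sq (hmono : ∀ u v : ℕ → ℝ, SeqBox γ u → SeqBox γ v → (∀ j, u j ≤ v j) → B u ≤ B v) (hL : ∀ k, 0 ≤ L k) (hb : 0 < b)
    (hlo : ∀ u, SeqBox γ u → b ≤ B u) (hdom : ∀ u, SeqBox γ u → ∑ k ∈ range K, L k * u k ≤ B u) (hh : SeqBox γ h) (hf : MemFlow B gIR h)
    (hg : ∀ t, 0 < g t ∧ g t ≤ 1) (hgF : ∀ t, 1 ≤ g t * (1 + ∑ k ∈ range K, L k * h (t + k) ^ 3 / 2)) {k : ℕ} (hk : 1 ≤ k)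
    (m d : ℕ) :
    (k : ℝ) ^ 2 * (L k * h (m + k) ^ 3 / 2)
      ≤ ((k : ℝ) + d) ^ 2 * (L k * h (m + d + k) ^ 3 / 2) * ∏ t ∈ Ico (m + k + 1) (m + k + 1 + d), g t := by
  have hpos : ∀ n, 0 < h n := fun n => (hh n).1
  have hanti := (strictAnti_of_memFlow hb hlo hh hf).antitone
  have hkr : (1 : ℝ) ≤ k := by exact_mod_cast hk
  have hd : (0 : ℝ) ≤ d := Nat.cast_nonneg d
  have hm : (0 : ℝ) ≤ m := Nat.cast_nonneg m
  have h1 := hpos (m + k)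
  have h2 := hpos (m + d + k)
  -- level persistence from the pin 0
  have hlev := mul_sq_le_from_pin hmono hb hlo hh hf 0 (m + k) d
  simp only [Nat.zero_add, Nat.cast_add] at hlev
  rw [show m + k + d = m + d + k by ring] at hlev
  have hle : h (m + d + k) ≤ h (m + k) := hanti (by omega)
  have hsq : (k : ℝ) * h (m + k) ^ 2 ≤ ((k : ℝ) + d) * h (m + d + k) ^ 2 := by
    nlinarith [mul_le_mul_of_nonneg_left (pow_le_pow_left₀ h2.le hle 2) hm]
  -- sharp damping persistence: Γ² ≥ (2(m+k)+1)∕(2(m+k)+2d+1) ≥ k∕(k+d)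
  set Γ : ℝ := ∏ t ∈ Ico (m + k + 1) (m + k + 1 + d), g t with hΓ
  have hΓ0 : 0 ≤ Γ := prod_nonneg fun t _ => (hg t).1.le
  have hΓsq := damping_prod_sq_ge hmono hL hb hlo hdom hh hf hg hgF (s := m + k + 1) (by omega) d
  rw [← hΓ] at hΓsq
  push_cast at hΓsq
  have hΓk : (k : ℝ) ≤ ((k : ℝ) + d) * Γ ^ 2 := by
    have hq : (k : ℝ) / ((k : ℝ) + d) ≤ (2 * ((m : ℝ) + k + 1) - 1) / (2 * ((m : ℝ) + k + 1) + 2 * d - 1) := by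
      rw [div_le_div_iff₀ (by positivity) (by linarith)]; nlinarith
    have := (hq.trans hΓsq)
    rwa [div_le_iff₀ (by positivity), mul_comm] at this
  -- squares: (k² h³)² ≤ ((k+d)² h′³ Γ)²
  have hcube6 : (k : ℝ) ^ 3 * h (m + k) ^ 6 ≤ ((k : ℝ) + d) ^ 3 * h (m + d + k) ^ 6 := by
    have := pow_le_pow_left₀ (by positivity) hsq 3
    nlinarith [this]
  have hmain : ((k : ℝ) ^ 2 * h (m + k) ^ 3) ^ 2 ≤ (((k : ℝ) + d) ^ 2 * h (m + d + k) ^ 3 * Γ) ^ 2 := by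
    have e1 : ((k : ℝ) ^ 2 * h (m + k) ^ 3) ^ 2 = (k : ℝ) * ((k : ℝ) ^ 3 * h (m + k) ^ 6) := by ring
    have e2 : (((k : ℝ) + d) ^ 2 * h (m + d + k) ^ 3 * Γ) ^ 2 = (((k : ℝ) + d) * Γ ^ 2) * (((k : ℝ) + d) ^ 3 * h (m + d + k) ^ 6) := by ring
    rw [e1, e2]
    exact mul_le_mul hΓk hcube6 (by positivity) (by positivity)
  have hroot : (k : ℝ) ^ 2 * h (m + k) ^ 3 ≤ ((k : ℝ) + d) ^ 2 * h (m + d + k) ^ 3 * Γ :=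
    le_of_pow_le_pow_left₀ two_ne_zero (by positivity) hmain
  have hLk := hL k
  calc (k : ℝ) ^ 2 * (L k * h (m + k) ^ 3 / 2) = (L k / 2) * ((k : ℝ) ^ 2 * h (m + k) ^ 3) := by ring
    _ ≤ (L k / 2) * (((k : ℝ) + d) ^ 2 * h (m + d + k) ^ 3 * Γ) := mul_le_mul_of_nonneg_left hroot (by positivity)
    _ = ((k : ℝ) + d) ^ 2 * (L k * h (m + d + k) ^ 3 / 2) * Γ := by ring

/-! ## §2 The old read varies slowly — constant three -/

/-- **THE OLD READ VARIES SLOWLY — CONSTANT THREE.**  Along every flow, for the self-consistent damping class and an age `k` (`0 < k < K`): if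
`ε ≥ 0` beyond the pin `m` and the own targets are bounded, `ε_q ≤ T` for `m < q ≤ m + k` (`T ≥ 0`), then for `1 ≤ d ≤ k`
`Σ_l KL k m l·ε_{m+1+l} − Σ_l KL k (m+d) l·ε_{m+d+1+l} ≤ 3d·c_k(m)·T` — `d` entering targets cost `≤ d·c_k(m)·T`, and on the common targets the
coefficient drops by at most `c_k(m)·(1 − (k∕(k+d))²) ≤ 2d·c_k(m)∕(k+d)` (`old_coeff_persist_sq`).  (E95b) `old_read_variation_of_bound` has `4 = 1 + 3`
from the cubic persistence; the proof is (E95b)'s verbatim with the square. [folklore] -/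
theorem old_read_variation_of_bound_three (hmono : ∀ u v : ℕ → ℝ, SeqBox γ u → SeqBox γ v → (∀ j, u j ≤ v j) → B u ≤ B v) (hL : ∀ k, 0 ≤ L k)
    (hb : 0 < b) (hlo : ∀ u, SeqBox γ u → b ≤ B u) (hdom : ∀ u, SeqBox γ u → ∑ k ∈ range K, L k * u k ≤ B u) (hh : SeqBox γ h)
    (hf : MemFlow B gIR h) (hg : ∀ t, 0 < g t ∧ g t ≤ 1) (hgF : ∀ t, 1 ≤ g t * (1 + ∑ k ∈ range K, L k * h (t + k) ^ 3 / 2))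
    {KL : ℕ → ℕ → ℕ → ℝ}
    (hKL : ∀ k n l, KL k n l = if 0 < k ∧ k < K ∧ l < k then L k * h (n + k) ^ 3 / 2 * ∏ t ∈ Ico (n + 1 + l) (n + k + 1), g t else 0)
    {k : ℕ} (hk : 0 < k) (hkK : k < K) {m d : ℕ} (hd1 : 1 ≤ d) (hdk : d ≤ k) {ε : ℕ → ℝ} {T : ℝ} (hT : 0 ≤ T)
    (hnn : ∀ q, m < q → 0 ≤ ε q) (hle : ∀ q, m < q → q ≤ m + k → ε q ≤ T) :
    ∑ l ∈ range K, KL k m l * ε (m + 1 + l) - ∑ l ∈ range K, KL k (m + d) l * ε (m + d + 1 + l)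
      ≤ 3 * d * (L k * h (m + k) ^ 3 / 2) * T := by
  have hpos : ∀ n, 0 < h n := fun n => (hh n).1
  have hP1 : ∀ a c : ℕ, ∏ t ∈ Ico a c, g t ≤ 1 := fun a c => prod_le_one (fun t _ => (hg t).1.le) fun t _ => (hg t).2
  have hP0 : ∀ a c : ℕ, 0 ≤ ∏ t ∈ Ico a c, g t := fun a c => prod_nonneg fun t _ => (hg t).1.le
  -- the two reads in window form; split the first window at d and re-index its far part
  rw [old_read_eq hKL hk hkK m ε, old_read_eq hKL hk hkK (m + d) ε, ← sum_range_add_sum_Ico _ hdk, sum_Ico_eq_sum_range]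
  set c : ℝ := L k * h (m + k) ^ 3 / 2 with hc
  set c' : ℝ := L k * h (m + d + k) ^ 3 / 2 with hc'
  set Γ : ℝ := ∏ t ∈ Ico (m + k + 1) (m + k + 1 + d), g t with hΓ
  have hc0 : 0 ≤ c := by have := hL k; have := hpos (m + k); positivity
  have hc'0 : 0 ≤ c' := by have := hL k; have := hpos (m + d + k); positivity
  have hkr : (0 : ℝ) < k := by exact_mod_cast hk
  have hdr : (1 : ℝ) ≤ d := by exact_mod_cast hd1
  have hdk' : (d : ℝ) ≤ k := by exact_mod_cast hdk
  -- the second read dominates its first k − d targets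
  have hsub : ∑ l ∈ range (k - d), c' * (∏ t ∈ Ico (m + d + 1 + l) (m + d + k + 1), g t) * ε (m + d + 1 + l)
      ≤ ∑ l ∈ range k, c' * (∏ t ∈ Ico (m + d + 1 + l) (m + d + k + 1), g t) * ε (m + d + 1 + l) :=
    sum_le_sum_of_subset_of_nonneg (range_mono (Nat.sub_le k d)) fun l _ _ =>
      mul_nonneg (mul_nonneg hc'0 (hP0 _ _)) (hnn (m + d + 1 + l) (by omega))
  -- on the common targets the damping product factors through Γ
  have hfac : ∀ l ∈ range (k - d), (∏ t ∈ Ico (m + d + 1 + l) (m + d + k + 1), g t)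
      = (∏ t ∈ Ico (m + 1 + (d + l)) (m + k + 1), g t) * Γ := by
    intro l hl
    have hl' := mem_range.mp hl
    rw [hΓ, show m + d + 1 + l = m + 1 + (d + l) by ring, show m + d + k + 1 = m + k + 1 + d by ring]
    exact (prod_Ico_consecutive _ (by omega) (by omega)).symm
  -- bound A: the d entering targets
  have hA : ∑ l ∈ range d, c * (∏ t ∈ Ico (m + 1 + l) (m + k + 1), g t) * ε (m + 1 + l) ≤ (d : ℝ) * (c * T) := by
    calc ∑ l ∈ range d, c * (∏ t ∈ Ico (m + 1 + l) (m + k + 1), g t) * ε (m + 1 + l) ≤ ∑ l ∈ range d, c * T := by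
          refine sum_le_sum fun l hl => ?_
          have hl' := mem_range.mp hl
          have h1 := hle (m + 1 + l) (by omega) (by omega)
          have h2 := hnn (m + 1 + l) (by omega)
          calc c * (∏ t ∈ Ico (m + 1 + l) (m + k + 1), g t) * ε (m + 1 + l) ≤ c * 1 * ε (m + 1 + l) :=
                mul_le_mul_of_nonneg_right (mul_le_mul_of_nonneg_left (hP1 _ _) hc0) h2
            _ ≤ c * T := by rw [mul_one]; exact mul_le_mul_of_nonneg_left h1 hc0
      _ = (d : ℝ) * (c * T) := by rw [sum_const, card_range, nsmul_eq_mul]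
  -- bound B: the coefficient drop on the common targets — SQUARE persistence (this file, §1)
  have hpers := old_coeff_persist_sq hmono hL hb hlo hdom hh hf hg hgF (show 1 ≤ k from hk) m d
  rw [← hc, ← hc', ← hΓ] at hpers
  have hdrop : c - c' * Γ ≤ 2 * d * c / ((k : ℝ) + d) := by
    have hkd : (0 : ℝ) < (k : ℝ) + d := by linarith
    set s : ℝ := (k : ℝ) + d with hs
    have hx : c * (k : ℝ) ^ 2 ≤ c' * Γ * s ^ 2 := by nlinarith [hpers]
    have h1 : (c - c' * Γ) * s ≤ (c - c * (k : ℝ) ^ 2 / s ^ 2) * s := by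
      have hX : c * (k : ℝ) ^ 2 / s ^ 2 ≤ c' * Γ := by rw [div_le_iff₀ (by positivity)]; exact hx
      exact mul_le_mul_of_nonneg_right (by linarith) hkd.le
    have hpoly : c * s ^ 2 - c * (k : ℝ) ^ 2 ≤ 2 * d * c * s := by
      have hd0 : (0 : ℝ) ≤ d := by linarith
      rw [hs]
      nlinarith [mul_nonneg hc0 (mul_nonneg hd0 hd0)]
    have h2 : (c - c * (k : ℝ) ^ 2 / s ^ 2) * s ≤ 2 * d * c := by
      rw [show (c - c * (k : ℝ) ^ 2 / s ^ 2) * s = (c * s ^ 2 - c * (k : ℝ) ^ 2) / s by field_simp,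
        div_le_iff₀ (by positivity)]
      exact hpoly
    rw [le_div_iff₀ hkd]
    exact h1.trans h2
  have hB : ∑ l ∈ range (k - d), c * (∏ t ∈ Ico (m + 1 + (d + l)) (m + k + 1), g t) * ε (m + 1 + (d + l))
      - ∑ l ∈ range (k - d), c' * (∏ t ∈ Ico (m + d + 1 + l) (m + d + k + 1), g t) * ε (m + d + 1 + l)
      ≤ ((k : ℝ) - d) * (2 * d * c / ((k : ℝ) + d) * T) := by
    rw [← sum_sub_distrib]
    calc ∑ l ∈ range (k - d), (c * (∏ t ∈ Ico (m + 1 + (d + l)) (m + k + 1), g t) * ε (m + 1 + (d + l))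
            - c' * (∏ t ∈ Ico (m + d + 1 + l) (m + d + k + 1), g t) * ε (m + d + 1 + l))
        ≤ ∑ l ∈ range (k - d), 2 * d * c / ((k : ℝ) + d) * T := by
          refine sum_le_sum fun l hl => ?_
          have hl' := mem_range.mp hl
          rw [hfac l hl, show m + d + 1 + l = m + 1 + (d + l) by ring]
          have hQ0 := hP0 (m + 1 + (d + l)) (m + k + 1)
          have hQ1 := hP1 (m + 1 + (d + l)) (m + k + 1)
          have hε0 := hnn (m + 1 + (d + l)) (by omega)
          have hεe := hle (m + 1 + (d + l)) (by omega) (by omega)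
          have e1 : c * (∏ t ∈ Ico (m + 1 + (d + l)) (m + k + 1), g t) * ε (m + 1 + (d + l))
              - c' * ((∏ t ∈ Ico (m + 1 + (d + l)) (m + k + 1), g t) * Γ) * ε (m + 1 + (d + l))
              = (c - c' * Γ) * ((∏ t ∈ Ico (m + 1 + (d + l)) (m + k + 1), g t) * ε (m + 1 + (d + l))) := by ring
          rw [e1]
          have h3 : 0 ≤ 2 * d * c / ((k : ℝ) + d) := by positivity
          calc (c - c' * Γ) * ((∏ t ∈ Ico (m + 1 + (d + l)) (m + k + 1), g t) * ε (m + 1 + (d + l)))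
              ≤ 2 * d * c / ((k : ℝ) + d) * ((∏ t ∈ Ico (m + 1 + (d + l)) (m + k + 1), g t) * ε (m + 1 + (d + l))) :=
                mul_le_mul_of_nonneg_right hdrop (mul_nonneg hQ0 hε0)
            _ ≤ 2 * d * c / ((k : ℝ) + d) * T := by
                refine mul_le_mul_of_nonneg_left ?_ h3
                calc (∏ t ∈ Ico (m + 1 + (d + l)) (m + k + 1), g t) * ε (m + 1 + (d + l)) ≤ 1 * ε (m + 1 + (d + l)) :=
                      mul_le_mul_of_nonneg_right hQ1 hε0
                  _ ≤ T := by rw [one_mul]; exact hεe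
      _ = ((k : ℝ) - d) * (2 * d * c / ((k : ℝ) + d) * T) := by
          rw [sum_const, card_range, nsmul_eq_mul, Nat.cast_sub hdk]
  -- assemble
  have hkd : (0 : ℝ) < (k : ℝ) + d := by linarith
  have hfin : ((k : ℝ) - d) * (2 * d * c / ((k : ℝ) + d) * T) ≤ 2 * d * (c * T) := by
    have hq : ((k : ℝ) - d) / ((k : ℝ) + d) ≤ 1 := by rw [div_le_one hkd]; linarith
    have e1 : ((k : ℝ) - d) * (2 * d * c / ((k : ℝ) + d) * T) = ((k : ℝ) - d) / ((k : ℝ) + d) * (2 * d * (c * T)) := by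
      field_simp
    rw [e1]
    have h3 : 0 ≤ 2 * d * (c * T) := by positivity
    nlinarith
  linarith [hA, hB, hsub, hfin]


end Summit.QuantumFields.BalabanUV.Beta.EriceRemainderEnclosureHistoryAutonomyComparisonAgeCompositionOldReadVariationThree
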